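import Literature.AlgebraicGeometry.AbelianSchemes.AbelianSchemeFibreBaseChange
import Literature.AlgebraicGeometry.Motives.AbelianVarietyCotangentOfFibreEndo
import Literature.AlgebraicGeometry.Morphisms.SectionConormalChartFinite
import Mathlib.RingTheory.Localization.Away.AdjoinRoot
import Mathlib.RingTheory.Localization.Submodule
import HarnessLib

/-!
# The cotangent characteristic polynomials of a ring acting on an abelian scheme spread out over a
# localisation of the base (Shimura 1998 §12.4 Prop. 26, proof p. 109; EGA IV₃ 8.9.4 / 8.10.5)

Topic `Literature/AlgebraicGeometry/AbelianSchemes`; namespace `Literature.AlgebraicGeometry.AbelianSchemes.AbelianScheme`.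
Cell `hodgecm-mathlib` (D-0151), row II-2β (`shimura1998_prop26_definedOverQbar` `_holds` programme), junction brick **J1**
(A-p14's split 04:54:45Z; statement fixed there).  THEOREMS only; no named fact, no `instance`, no `sorry` (net debt 0).
HC_CM is proved only modulo the 7 printed citations until rung 0 closes.

THE PRINT.  [Shimura1998] §12.4 Prop. 26, proof p. 109: «(A, ι) is defined over a finitely generated extension `k` of `ℚ`
[…] take a specialization […] over `ℚ̄` […] we obtain a structure `(A′, ι′)` of the SAME TYPE»: the type of `(A′, ι′)` is read
on the characteristic polynomials of `ι′(a)` acting on the cotangent space at the origin, and these are the specialisations of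
ONE family of polynomials with coefficients in (a localisation of) the coordinate ring of the model — [EGAIV3] (8.9.4) generic
freeness of the conormal module of the unit section over a dense open `D(r)` of the integral base, (8.10.5) spreading out;
[GortzWedhorn2023] Remark 17.14 / 17.15 (1): the conormal module of a section is functorial and commutes with base change.

WHAT IS PROVED (`R` a noetherian domain, `𝒜 : AbelianScheme R`, `act : RingAction O 𝒜` a presented action of a commutative ring).
* §1 algebra: `exists_comp_eq_and_injective_of_away` (an injective ring map from a domain to a field extends injectively to
  `R[1/x]`, `x ≠ 0`); `charpoly_baseChange_eq_map_of_isScalarTower` (two-step base change of a characteristic polynomial through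
  an intermediate ring over which the module becomes free).
* §2 geometry of the «two-step fibre»: for `R → R₁ → R₂ → κ`, the fibre `(𝒜_{R₂})_φ` is a pullback of `𝒜_{R₁}` along
  `Spec κ → Spec R₁` (`isPullback_fibreToBaseChange`), with the origin over the unit section (`unitPt_comp_fibreToBaseChange`) and
  the specialised endomorphisms covering the base-changed ones (`toSchemeHom_fibreEnd_comp_fibreToBaseChange`) — the hypotheses
  `(hP) (horig) (hu)` of `Motives/AbelianVarietyCotangentOfFibreEndo` for this square.
* §3 **`exists_localization_charpoly_cotangentMap_fibre`** (J1): there are a finite-type `R`-algebra `R₂` (a domain: `R[1/s][1/r]`),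
  to which every injective field-valued point of `R` extends injectively, and polynomials `Q a ∈ R₂[X]` (`a ∈ O`) such that for
  EVERY field-valued point `φ : R₂ → κ` the characteristic polynomial of `ι_φ(a)` on the cotangent space at the origin of the fibre
  `(𝒜_{R₂})_φ` is `(Q a)^φ`.  (Chart of the unit section after inverting `s`, `AbelianSchemeUnitSectionChart`; conormal module
  `I/I²` of the section finite over `R[1/s]` (A-p10's `finite_cotangent_sectionAug_of_isNoetherianRing`), free after inverting
  `r` (`exists_ne_zero_free_localizedModule_away`); `Q a` := the
  characteristic polynomial over `R₂` of `γ_a ⊗ R₂`, `γ_a = sectionConormalEndo` of [GortzWedhorn2023] Remark 17.14; comparison with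
  the fibre by A-p03's `cotangentMap_eq_conj`.)
* §4 `dim_fibre_of_isOfRelDim`: the fibres of an abelian scheme of relative dimension `g` have dimension `g`.

## References
* [Shimura1998] G. Shimura, *Abelian Varieties with Complex Multiplication and Modular Functions* (1998), §12.4 Prop. 26 (proof p. 109).
* [EGAIV3] A. Grothendieck, J. Dieudonné, *EGA IV₃*, Publ. Math. IHÉS 28 (1966), (8.9.4), (8.10.5).
* [GortzWedhorn2023] U. Görtz, T. Wedhorn, *Algebraic Geometry II* (2023), Remark 17.14, Remark 17.15 (1).
* [GortzWedhorn2020] U. Görtz, T. Wedhorn, *Algebraic Geometry I*, 2nd ed. (2020), Section (4.7), Remark 6.12 (2)–(3), Remark 16.54.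
-/

set_option autoImplicit false

noncomputable section

-- `TopCat.Presheaf` is not reducible (as in Mathlib's `AlgebraicGeometry/Modules` and the tree's `Morphisms/SectionConormalChart`).
set_option backward.isDefEq.respectTransparency false

universe u v

open CategoryTheory CategoryTheory.Limits AlgebraicGeometry MonoidalCategory TensorProduct Polynomial
open Literature.RingTheory.Smooth Literature.AlgebraicGeometry.Morphisms

namespace Literature.AlgebraicGeometry.AbelianSchemes

open Literature.AlgebraicGeometry.Motives (SchemeOver AbelianVariety)
open scoped MonObj Obj

/-! ## §1 Algebra -/

/-- **Injective field-valued points extend injectively to `R[1/x]`** (`R` a domain, `x ≠ 0`): for `χ : R → C` injective into a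
field, `χ x ≠ 0` is a unit, `χ` extends to `R[1/x]` (`IsLocalization.Away.lift`), and the extension is injective
(`IsLocalization.injective_iff_map_algebraMap_eq`: `R → R[1/x]` is injective as well). [cite: EGAIV3, (8.10.5)] -/
theorem exists_comp_eq_and_injective_of_away {R : Type u} [CommRing R] [IsDomain R] {x : R} (hx : x ≠ 0)
    (S : Type v) [CommRing S] [Algebra R S] [IsLocalization.Away x S]
    (C : Type*) [Field C] (χ : R →+* C) (hχ : Function.Injective χ) :
    ∃ χ' : S →+* C, χ'.comp (algebraMap R S) = χ ∧ Function.Injective χ' := by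
  have hxu : IsUnit (χ x) := isUnit_iff_ne_zero.mpr fun h0 => hx (hχ (by rw [h0, map_zero]))
  refine ⟨IsLocalization.Away.lift x hxu, IsLocalization.Away.lift_comp x hxu, ?_⟩
  rw [IsLocalization.injective_iff_map_algebraMap_eq (Submonoid.powers x)]
  intro a b
  rw [IsLocalization.Away.lift_eq, IsLocalization.Away.lift_eq,
    (IsLocalization.injective S (powers_le_nonZeroDivisors_of_noZeroDivisors hx)).eq_iff, hχ.eq_iff]

/-- **Two-step base change of a characteristic polynomial.**  For an `R₁`-linear endomorphism `γ` of `M`, an `R₁`-algebra `R₂`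
over which `R₂ ⊗ M` is free of finite rank, and an `R₂`-algebra `κ` (compatibly an `R₁`-algebra): the characteristic polynomial
of `γ ⊗ κ` is the image under `R₂ → κ` of that of `γ ⊗ R₂` (`κ ⊗_{R₁} M = κ ⊗_{R₂} (R₂ ⊗_{R₁} M)`, Mathlib `cancelBaseChange`,
and `LinearMap.charpoly_baseChange`). [cite: EGAIV3, (8.9.4)] -/
theorem charpoly_baseChange_eq_map_of_isScalarTower {R₁ : Type*} [CommRing R₁] (R₂ : Type*) [CommRing R₂] [Algebra R₁ R₂]
    (κ : Type*) [CommRing κ] [Algebra R₁ κ] [Algebra R₂ κ] [IsScalarTower R₁ R₂ κ]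
    {M : Type*} [AddCommGroup M] [Module R₁ M] (γ : M →ₗ[R₁] M)
    [Module.Free R₂ (R₂ ⊗[R₁] M)] [Module.Finite R₂ (R₂ ⊗[R₁] M)]
    [Module.Free κ (κ ⊗[R₁] M)] [Module.Finite κ (κ ⊗[R₁] M)] :
    (γ.baseChange κ).charpoly = ((γ.baseChange R₂).charpoly).map (algebraMap R₂ κ) := by
  let e : κ ⊗[R₂] (R₂ ⊗[R₁] M) ≃ₗ[κ] κ ⊗[R₁] M := TensorProduct.AlgebraTensorModule.cancelBaseChange R₁ R₂ κ κ M
  -- naturality of `cancelBaseChange` in the endomorphism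
  have hnat : γ.baseChange κ ∘ₗ e.toLinearMap = e.toLinearMap ∘ₗ (γ.baseChange R₂).baseChange κ := by
    refine TensorProduct.AlgebraTensorModule.ext fun c y => ?_
    simp only [LinearMap.comp_apply, LinearEquiv.coe_coe, LinearMap.baseChange_tmul]
    induction y using TensorProduct.induction_on with
    | zero => simp only [tmul_zero, map_zero]
    | add y z hy hz => simp only [tmul_add, map_add, hy, hz]
    | tmul b m =>
      simp only [e, TensorProduct.AlgebraTensorModule.cancelBaseChange_tmul, LinearMap.baseChange_tmul]
  have hconj : e.conj ((γ.baseChange R₂).baseChange κ) = γ.baseChange κ := by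
    apply LinearMap.ext
    intro z
    obtain ⟨w, rfl⟩ := e.surjective z
    rw [LinearEquiv.conj_apply, LinearMap.comp_apply, LinearMap.comp_apply, LinearEquiv.coe_coe, LinearEquiv.coe_coe,
      LinearEquiv.symm_apply_apply]
    exact (LinearMap.congr_fun hnat w).symm
  rw [← hconj, LinearEquiv.charpoly_conj, LinearMap.charpoly_baseChange]

namespace AbelianScheme

/-! ## §2 The two-step fibre as a pullback of the intermediate base change -/

section TwoStep

variable {R : Type u} [CommRing R] (𝒜 : AbelianScheme R) (R₁ : Type u) [CommRing R₁] [Algebra R R₁]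
  (R₂ : Type u) [CommRing R₂] [Algebra R R₂] [Algebra R₁ R₂] [IsScalarTower R R₁ R₂]
  {κ : Type u} [Field κ] (φ : R₂ →+* κ)

/-- `Spec φ ≫ Spec (R → R₂) = Spec (φ ∘ (R₁ → R₂)) ≫ Spec (R → R₁)` (the scalar tower `R → R₁ → R₂`).
[cite: GortzWedhorn2020, Section (4.7)] -/
theorem specMap_comp_specMap_eq_of_isScalarTower :
    specMap φ ≫ specMap (algebraMap R R₂) = specMap (φ.comp (algebraMap R₁ R₂)) ≫ specMap (algebraMap R R₁) := by
  rw [← specMap_comp, ← specMap_comp, RingHom.comp_assoc, ← IsScalarTower.algebraMap_eq R R₁ R₂]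

/-- **The comparison map `(𝒜_{R₂})_φ → 𝒜_{R₁}`** over `Spec (φ ∘ (R₁ → R₂)) : Spec κ → Spec R₁`: the fibre of `𝒜_{R₂}` at `φ`
maps to `𝒜` through `𝒜_{R₂}`, and to `Spec R₁` through `Spec κ`; the induced morphism to `𝒜_{R₁} = 𝒜 ×_{Spec R} Spec R₁`.
[cite: GortzWedhorn2020, Section (4.7)] -/
def fibreToBaseChange : ((𝒜.baseChange (algebraMap R R₂)).fibre φ).X.left ⟶ (𝒜.baseChange (algebraMap R R₁)).left :=
  pullback.lift
    (pullback.fst (𝒜.baseChange (algebraMap R R₂)).X.hom (specMap φ) ≫ pullback.fst 𝒜.X.hom (specMap (algebraMap R R₂)))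
    (((𝒜.baseChange (algebraMap R R₂)).fibre φ).X.hom ≫ specMap (φ.comp (algebraMap R₁ R₂)))
    (by
      rw [Category.assoc, Category.assoc, ← specMap_comp_specMap_eq_of_isScalarTower (R := R) R₁ R₂ φ]
      have h₂ : pullback.fst 𝒜.X.hom (specMap (algebraMap R R₂)) ≫ 𝒜.X.hom =
          (𝒜.baseChange (algebraMap R R₂)).X.hom ≫ specMap (algebraMap R R₂) := pullback.condition
      have h₁ : pullback.fst (𝒜.baseChange (algebraMap R R₂)).X.hom (specMap φ) ≫ (𝒜.baseChange (algebraMap R R₂)).X.hom =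
          ((𝒜.baseChange (algebraMap R R₂)).fibre φ).X.hom ≫ specMap φ := pullback.condition
      rw [h₂, ← Category.assoc, h₁, Category.assoc])

/-- `fibreToBaseChange ≫ pr₁ = q ≫ pr₂` (first component). [cite: GortzWedhorn2020, Section (4.7)] -/
@[simp]
theorem fibreToBaseChange_comp_fst :
    𝒜.fibreToBaseChange R₁ R₂ φ ≫ pullback.fst 𝒜.X.hom (specMap (algebraMap R R₁)) =
      pullback.fst (𝒜.baseChange (algebraMap R R₂)).X.hom (specMap φ) ≫ pullback.fst 𝒜.X.hom (specMap (algebraMap R R₂)) :=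
  pullback.lift_fst _ _ _

/-- `fibreToBaseChange ≫ (𝒜_{R₁} → Spec R₁) = ((𝒜_{R₂})_φ → Spec κ) ≫ Spec (φ ∘ (R₁ → R₂))` (second component).
[cite: GortzWedhorn2020, Section (4.7)] -/
@[simp]
theorem fibreToBaseChange_comp_hom :
    𝒜.fibreToBaseChange R₁ R₂ φ ≫ (𝒜.baseChange (algebraMap R R₁)).X.hom =
      ((𝒜.baseChange (algebraMap R R₂)).fibre φ).X.hom ≫ specMap (φ.comp (algebraMap R₁ R₂)) :=
  pullback.lift_snd _ _ _

/-- **The two-step fibre square is cartesian**: `(𝒜_{R₂})_φ` is the pullback of `𝒜_{R₁} → Spec R₁` along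
`Spec (φ ∘ (R₁ → R₂)) : Spec κ → Spec R₁` (pasting: `(𝒜_{R₂})_φ → 𝒜_{R₂} → 𝒜` is cartesian over `Spec κ → Spec R₂ → Spec R`, and so
is `𝒜_{R₁} → 𝒜`; Mathlib `IsPullback.of_right`). [cite: GortzWedhorn2020, Section (4.7) (transitivity of fibre products)] -/
theorem isPullback_fibreToBaseChange :
    IsPullback (𝒜.fibreToBaseChange R₁ R₂ φ) ((𝒜.baseChange (algebraMap R R₂)).fibre φ).X.hom
      (𝒜.baseChange (algebraMap R R₁)).X.hom (specMap (φ.comp (algebraMap R₁ R₂))) := by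
  -- the right square `𝒜_{R₁} → 𝒜` over `Spec R₁ → Spec R`
  have t : IsPullback (pullback.fst 𝒜.X.hom (specMap (algebraMap R R₁))) (𝒜.baseChange (algebraMap R R₁)).X.hom 𝒜.X.hom
      (specMap (algebraMap R R₁)) :=
    IsPullback.of_hasPullback _ _
  -- the outer rectangle `(𝒜_{R₂})_φ → 𝒜_{R₂} → 𝒜` over `Spec κ → Spec R₂ → Spec R`
  have s₂ : IsPullback (pullback.fst 𝒜.X.hom (specMap (algebraMap R R₂))) (𝒜.baseChange (algebraMap R R₂)).X.hom 𝒜.X.hom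
      (specMap (algebraMap R R₂)) :=
    IsPullback.of_hasPullback _ _
  have s : IsPullback (𝒜.fibreToBaseChange R₁ R₂ φ ≫ pullback.fst 𝒜.X.hom (specMap (algebraMap R R₁)))
      ((𝒜.baseChange (algebraMap R R₂)).fibre φ).X.hom 𝒜.X.hom
      (specMap (φ.comp (algebraMap R₁ R₂)) ≫ specMap (algebraMap R R₁)) := by
    rw [fibreToBaseChange_comp_fst, ← specMap_comp_specMap_eq_of_isScalarTower (R := R) R₁ R₂ φ]
    exact ((𝒜.baseChange (algebraMap R R₂)).isPullback_fibre φ).paste_horiz s₂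
  exact s.of_right (𝒜.fibreToBaseChange_comp_hom R₁ R₂ φ) t

/-- **The origin of the two-step fibre lies over the unit section of `𝒜_{R₁}`**:
`e_{(𝒜_{R₂})_φ} ≫ fibreToBaseChange = Spec (φ ∘ (R₁ → R₂)) ≫ e_{𝒜_{R₁}}`. [cite: GortzWedhorn2020, Remark 16.54] -/
theorem unitPt_comp_fibreToBaseChange :
    AbelianVariety.unitPt ((𝒜.baseChange (algebraMap R R₂)).fibre φ) ≫ 𝒜.fibreToBaseChange R₁ R₂ φ =
      specMap (φ.comp (algebraMap R₁ R₂)) ≫ η[(𝒜.baseChange (algebraMap R R₁)).X].left := by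
  apply pullback.hom_ext
  · rw [Category.assoc, fibreToBaseChange_comp_fst, ← Category.assoc, unitPt_fibre_comp_fst, Category.assoc,
      unit_baseChange_left_comp_fst, Category.assoc, unit_baseChange_left_comp_fst, ← Category.assoc, ← Category.assoc,
      specMap_comp_specMap_eq_of_isScalarTower (R := R) R₁ R₂ φ]
  · rw [Category.assoc, Category.assoc, ← baseChange_hom, fibreToBaseChange_comp_hom, unit_left_comp_hom, ← Category.assoc,
      AbelianVariety.unitPt_comp_hom, Category.id_comp]
    exact (Category.comp_id _).symm

/-- **The specialised endomorphism covers the base-changed one**: for a presented ring action `act` on `𝒜` and `a ∈ O`,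
`(ι_φ a) ≫ fibreToBaseChange = fibreToBaseChange ≫ (ιR a)_{R₁}` on underlying schemes. [cite: GortzWedhorn2020, Section (4.7)]
[cite: Shimura1998, §12.4 Prop. 26 (proof, p. 109)] -/
theorem toSchemeHom_fibreEnd_comp_fibreToBaseChange {O : Type v} [CommRing O] (act : RingAction O 𝒜) (a : O) :
    haveI := (act.baseChange (algebraMap R R₂)).isMonHom
    AbelianVariety.Hom.toSchemeHom
        (((𝒜.baseChange (algebraMap R R₂)).fibreEnd φ ((act.baseChange (algebraMap R R₂)).ιR a))) ≫
        𝒜.fibreToBaseChange R₁ R₂ φ =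
      𝒜.fibreToBaseChange R₁ R₂ φ ≫ ((act.baseChange (algebraMap R R₁)).ιR a).left := by
  haveI := (act.baseChange (algebraMap R R₂)).isMonHom
  apply pullback.hom_ext
  · rw [Category.assoc, fibreToBaseChange_comp_fst, ← Category.assoc, toSchemeHom_fibreEnd_comp_fst, Category.assoc,
      RingAction.baseChange_ιR_left_comp_fst, Category.assoc, RingAction.baseChange_ιR_left_comp_fst, ← Category.assoc,
      ← Category.assoc, fibreToBaseChange_comp_fst]
  · rw [Category.assoc, Category.assoc, ← baseChange_hom, fibreToBaseChange_comp_hom, left_comp_hom, fibreToBaseChange_comp_hom,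
      ← Category.assoc]
    congr 1
    exact Over.w _

end TwoStep

/-! ## §3 The spread-out characteristic polynomials -/

/-- **J1 — the cotangent characteristic polynomials of `ι(a)` spread out over a localisation of the base.**  Let `𝒜` be an
abelian scheme over a noetherian domain `R` with a presented action `act` of a commutative ring `O`.  There are an `R`-algebra
`R₂` of finite type which is a domain and to which every injective ring map from `R` to a field extends injectively (namely
`R₂ = R[1/s][1/r]`), and polynomials `Q a ∈ R₂[X]`, such that for every field-valued point `φ : R₂ → κ` and every `a ∈ O` the
characteristic polynomial of the specialised endomorphism `ι_φ(a)` on the cotangent space at the origin of the fibre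
`(𝒜_{R₂})_φ` is `(Q a)^φ`.  (Shimura's specialisation argument for the type, in scheme language: after shrinking `Spec R` the
conormal module of the unit section is free and carries the action; its characteristic polynomials specialise to every fibre.)
[cite: Shimura1998, §12.4 Prop. 26 (proof, p. 109)] [cite: EGAIV3, (8.9.4) and (8.10.5)] [cite: GortzWedhorn2023, Remark 17.14 and Remark 17.15 (1)] -/
theorem exists_localization_charpoly_cotangentMap_fibre {R : Type u} [CommRing R] [IsDomain R] [IsNoetherianRing R]
    (𝒜 : AbelianScheme R) {O : Type v} [CommRing O] (act : RingAction O 𝒜) :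
    ∃ (R₂ : Type u) (_ : CommRing R₂) (_ : IsDomain R₂) (_ : Algebra R R₂) (_ : Algebra.FiniteType R R₂)
      (_ : ∀ (C : Type u) [Field C] (χ : R →+* C), Function.Injective χ →
        ∃ χ₂ : R₂ →+* C, χ₂.comp (algebraMap R R₂) = χ ∧ Function.Injective χ₂)
      (Q : O → R₂[X]),
      ∀ (κ : Type u) [Field κ] (φ : R₂ →+* κ) (a : O),
        (haveI := (act.baseChange (algebraMap R R₂)).isMonHom;
        (AbelianVariety.cotangentMap ((𝒜.baseChange (algebraMap R R₂)).fibre φ)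
          ((𝒜.baseChange (algebraMap R R₂)).fibreEnd φ ((act.baseChange (algebraMap R R₂)).ιR a))).charpoly) =
          (Q a).map φ := by
  classical
  -- STEP 1 — an affine chart of the unit section after inverting `s ≠ 0` (`AbelianSchemeUnitSectionChart`).
  obtain ⟨s, hs0, W₀, hW₀, -, hchart⟩ := 𝒜.exists_unitSection_chart
  -- `R₁ = R[1/s]`, taken ABSTRACTLY (any `IsLocalization.Away s`; keeps the instance paths of the iterated localisation first-order)
  obtain ⟨R₁, _, _, _⟩ : ∃ (R₁ : Type u) (_ : CommRing R₁) (_ : Algebra R R₁), IsLocalization.Away s R₁ :=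
    ⟨Localization.Away s, inferInstance, inferInstance, inferInstance⟩
  haveI : IsDomain R₁ := IsLocalization.isDomain_of_le_nonZeroDivisors R₁ (powers_le_nonZeroDivisors_of_noZeroDivisors hs0)
  haveI : IsNoetherianRing R₁ := IsLocalization.isNoetherianRing (Submonoid.powers s) R₁ inferInstance
  haveI : Algebra.FinitePresentation R R₁ := IsLocalization.Away.finitePresentation s
  obtain ⟨hW₁, heW₁⟩ := hchart R₁ (algebraMap R R₁) (IsLocalization.Away.algebraMap_isUnit s)
  -- the model over `R₁`, its unit section `e₁`, the chart `W₁`, the augmentation `ε₁` and the conormal module `M₁ = I/I²`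
  let 𝒜₁ : AbelianScheme R₁ := 𝒜.baseChange (algebraMap R R₁)
  let ε₁ := sectionAug 𝒜₁.X.hom η[𝒜₁.X].left 𝒜₁.unit_left_comp_hom heW₁
  -- STEP 2 — `I/I²` is finite over the noetherian `R₁`, hence finitely presented, hence free after inverting some `r ≠ 0`.
  haveI := 𝒜₁.isProper
  haveI hM₁ : Module.Finite R₁ (augIdeal ε₁).Cotangent :=
    finite_cotangent_sectionAug_of_isNoetherianRing 𝒜₁.X.hom η[𝒜₁.X].left 𝒜₁.unit_left_comp_hom heW₁ hW₁
  haveI : Module.FinitePresentation R₁ (augIdeal ε₁).Cotangent := Module.finitePresentation_of_finite R₁ _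
  obtain ⟨r, hr0, hfree, -⟩ := exists_ne_zero_free_localizedModule_away (R := R₁) (augIdeal ε₁).Cotangent
  let R₂ : Type u := Localization.Away r
  haveI : IsDomain R₂ := IsLocalization.isDomain_localization (powers_le_nonZeroDivisors_of_noZeroDivisors hr0)
  haveI : Algebra.FinitePresentation R₁ R₂ := IsLocalization.Away.finitePresentation r
  haveI := hfree
  haveI : Module.Free R₂ (R₂ ⊗[R₁] (augIdeal ε₁).Cotangent) :=
    Module.Free.of_equiv (LocalizedModule.equivTensorProduct (Submonoid.powers r) (augIdeal ε₁).Cotangent)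
  haveI : Module.Finite R₂ (R₂ ⊗[R₁] (augIdeal ε₁).Cotangent) := inferInstance
  have hFT : Algebra.FiniteType R R₂ :=
    Algebra.FiniteType.trans (S := R₁) inferInstance inferInstance
  have hext : ∀ (C : Type u) [Field C] (χ : R →+* C), Function.Injective χ →
      ∃ χ₂ : R₂ →+* C, χ₂.comp (algebraMap R R₂) = χ ∧ Function.Injective χ₂ := by
    intro C _ χ hχ
    obtain ⟨χ₁, hχ₁, hχ₁i⟩ := exists_comp_eq_and_injective_of_away hs0 R₁ C χ hχ
    obtain ⟨χ₂, hχ₂, hχ₂i⟩ := exists_comp_eq_and_injective_of_away hr0 R₂ C χ₁ hχ₁i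
    refine ⟨χ₂, ?_, hχ₂i⟩
    rw [IsScalarTower.algebraMap_eq R R₁ R₂, ← RingHom.comp_assoc, hχ₂, hχ₁]
  -- STEP 3 — the action on the model over `R₁`; for each `a` a basic open `D(h_a) ⊆ W₁ ∩ (ι a)⁻¹ W₁` containing the unit
  -- section, and the endomorphism `γ_a` of `I/I²` ([GortzWedhorn2023] Remark 17.14, `sectionConormalEndo`).
  let act₁ := act.baseChange (algebraMap R R₁)
  haveI := act₁.isMonHom
  have hev : ∀ a, η[𝒜₁.X].left ≫ (act₁.ιR a).left = η[𝒜₁.X].left := fun a => 𝒜₁.unit_left_comp_left (act₁.ιR a)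
  have hv : ∀ a, (act₁.ιR a).left ≫ 𝒜₁.X.hom = 𝒜₁.X.hom := fun a => 𝒜₁.left_comp_hom (act₁.ιR a)
  have heO : ∀ a, η[𝒜₁.X].left ⁻¹ᵁ ((act₁.ιR a).left ⁻¹ᵁ (pullback.fst 𝒜.X.hom (specMap (algebraMap R R₁)) ⁻¹ᵁ W₀)) = ⊤ :=
    fun a => by rw [← Scheme.Hom.comp_preimage, hev a]; exact heW₁
  have hh := fun a =>
    exists_sectionAug_eq_one_and_basicOpen_le 𝒜₁.X.hom η[𝒜₁.X].left 𝒜₁.unit_left_comp_hom heW₁ hW₁ _ (heO a)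
  choose h hh1 hhv using hh
  let γ : O → ((augIdeal ε₁).Cotangent →ₗ[R₁] (augIdeal ε₁).Cotangent) := fun a =>
    sectionConormalEndo 𝒜₁.X.hom η[𝒜₁.X].left 𝒜₁.unit_left_comp_hom heW₁ (act₁.ιR a).left (hv a) (hev a) (h a) (hhv a)
      hW₁ (hh1 a)
  -- STEP 4 — `R₂` and `Q a := char(γ_a ⊗ R₂)`.
  let Q : O → R₂[X] := fun a => ((γ a).baseChange R₂).charpoly
  refine ⟨R₂, inferInstance, inferInstance, inferInstance, hFT, hext, Q, ?_⟩
  intro κ _ φ a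
  letI : Algebra R₂ κ := φ.toAlgebra
  letI : Algebra R₁ κ := (φ.comp (algebraMap R₁ R₂)).toAlgebra
  haveI : IsScalarTower R₁ R₂ κ := IsScalarTower.of_algebraMap_eq fun _ => rfl
  -- STEP 5 — the fibre `(𝒜_{R₂})_φ` is a pullback of the model `𝒜₁` along `Spec κ → Spec R₁` (§2), so the cotangent map of
  -- `ι_φ(a)` is conjugate to `γ_a ⊗ κ` (A-p03's `cotangentMap_eq_conj`, which needs no freeness).
  let A := (𝒜.baseChange (algebraMap R R₂)).fibre φ
  let p := 𝒜.fibreToBaseChange R₁ R₂ φ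
  have hP : IsPullback p A.X.hom 𝒜₁.X.hom (Spec.map (CommRingCat.ofHom (algebraMap R₁ κ))) :=
    𝒜.isPullback_fibreToBaseChange R₁ R₂ φ
  have horig : AbelianVariety.unitPt A ≫ p = Spec.map (CommRingCat.ofHom (algebraMap R₁ κ)) ≫ η[𝒜₁.X].left :=
    𝒜.unitPt_comp_fibreToBaseChange R₁ R₂ φ
  have hU : IsAffineOpen (p ⁻¹ᵁ (pullback.fst 𝒜.X.hom (specMap (algebraMap R R₁)) ⁻¹ᵁ W₀)) :=
    isAffineOpen_preimage_of_isPullback 𝒜₁.X.hom p A.X.hom hP hW₁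
  have heU : AbelianVariety.origin A ∈ p ⁻¹ᵁ (pullback.fst 𝒜.X.hom (specMap (algebraMap R R₁)) ⁻¹ᵁ W₀) :=
    AbelianVariety.origin_mem_preimage η[𝒜₁.X].left A p horig _ heW₁
  haveI := (act.baseChange (algebraMap R R₂)).isMonHom
  let u : A ⟶ A := (𝒜.baseChange (algebraMap R R₂)).fibreEnd φ ((act.baseChange (algebraMap R R₂)).ιR a)
  have hu : AbelianVariety.Hom.toSchemeHom u ≫ p = p ≫ (act₁.ιR a).left :=
    𝒜.toSchemeHom_fibreEnd_comp_fibreToBaseChange R₁ R₂ φ act a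
  have hconj := AbelianVariety.cotangentMap_eq_conj 𝒜₁.X.hom η[𝒜₁.X].left 𝒜₁.unit_left_comp_hom hW₁ heW₁ A p hP horig
    hU heU (act₁.ιR a).left (hv a) (hev a) u hu (h a) (hh1 a) (hhv a)
  -- STEP 6 — characteristic polynomials: conjugation, then the two-step base change `R₁ → R₂ → κ`.
  change (AbelianVariety.cotangentMap A u).charpoly = (((γ a).baseChange R₂).charpoly).map (algebraMap R₂ κ)
  rw [hconj, LinearEquiv.charpoly_conj]
  exact charpoly_baseChange_eq_map_of_isScalarTower R₂ κ (γ a)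

/-! ## §4 The dimension of the fibres -/

/-- **The fibres of an abelian scheme of relative dimension `g` are abelian varieties of dimension `g`** (relative dimension is
stable under base change, and over a field it is the dimension: uniqueness of the relative dimension of a smooth morphism with
non-empty source). [cite: GortzWedhorn2020, Remark 16.54] -/
theorem dim_fibre_of_isOfRelDim {R : Type u} [CommRing R] {𝒜 : AbelianScheme R} {g : ℕ} (h : 𝒜.IsOfRelDim g)
    {κ : Type u} [Field κ] (φ : R →+* κ) : (𝒜.fibre φ).dim = g := by
  have h₁ : SmoothOfRelativeDimension g (𝒜.baseChange φ).X.hom := h.baseChange φ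
  have h₂ : SmoothOfRelativeDimension (𝒜.fibre φ).dim (𝒜.baseChange φ).X.hom := (𝒜.baseChange φ).isOfRelDim_dim
  haveI : Nonempty (𝒜.baseChange φ).X.left := ⟨AbelianVariety.origin (𝒜.fibre φ)⟩
  exact Literature.AlgebraicGeometry.Motives.AbelianVarietyProofs.eq_of_smoothOfRelativeDimension _ h₂ h₁

end AbelianScheme

end Literature.AlgebraicGeometry.AbelianSchemes

end
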